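import Summits.CriticalPhenomena.SAWScalingLimit.Theses.SAWReversalUpgrade
import Summits.CriticalPhenomena.SAWScalingLimit.Theorems.SAWReversalUpgradeAttachNoReturnPolyline
import HarnessLib

/-!
# `NoDeepReturn`, line `naked-root-localisation`: polyline event ⇒ vertex event

Stub 1 (`stub_polylineToVertex`) of line SketchIdeator2 for the crux
`Summit.CriticalPhenomena.SAWScalingLimit.Theses.SAWReversalUpgrade.NoDeepReturn`
(item `stmt-CriticalPhenomena-18004`, route `SAWReversalUpgrade`, sub-problem `SAWScalingLimit`).

The crux is stated through the dyadic polyline `γ.walk.toCurve (meshPoint δ)` of a self-avoiding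
walk `γ` of `Ω_δ ⊆ δℤ²`: "`ε`-far from `c` at some time `s`, `r`-close to `c` at a later time `t`".
The line works with VERTICES of the walk instead. This file proves the reduction: if `r + δ < ε`,
the polyline event forces a vertex `γ_i` with `dist(δγ_i, c) ≥ ε` and a LATER vertex `γ_j`
(`i < j ≤ |γ|`) with `dist(δγ_j, c) ≤ r + δ`.

Proof (elementary): by the tree's factorisation `polyline = uniform ∘ clock`
(`AttachNoReturn.toCurve_apply_eq_uniform_clock`) and `AttachNoReturn.uniform_walk_mem_segment`,
the point `P(s)` lies on a closed lattice edge `[δγ_k, δγ_{k+1}]` with `k ≤ clock s ≤ k + 1`, and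
`P(t)` on an edge `[δγ_m, δγ_{m+1}]` with `m ≤ clock t ≤ m + 1`; edges have length `δ`
(`AttachNoReturn.dist_meshPoint_getVert_succ`).
* FAR: the open ball `B(c, ε)` is convex, so one endpoint of the edge through `P(s)` is `ε`-far.
* NEAR: `δγ_{m+1}` is within `δ` of `P(t)`, hence `(r + δ)`-close to `c`; take `j := m + 1`.
* ORDER: `dist(P s, P t) ≥ ε - r > δ`, so `clock s < clock t` (monotone clock), whence
  `k < m + 1`; and `k = m` is impossible (two points of one edge are at distance `≤ δ`), so
  `k + 1 < m + 1` as well when the far endpoint is `δγ_{k+1}`.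
The degenerate walk (`|γ| = 0`) cannot carry the event (`clock ≡ 0` forces `P s = P t`).

No measure theory, no lattice input beyond the two cited tree lemmas; Mathlib's `convex_ball`,
`Convex.segment_subset`, `dist_add_dist_of_mem_segment`.
-/

noncomputable section

namespace Summit.CriticalPhenomena.SAWScalingLimit.Theorems.NoDeepReturn.NakedRoot

open MeasureTheory Filter Topology Set Metric
open scoped ENNReal
open Literature.Probability.LatticeModels (Site meshPoint discreteDomainGraph)
open Literature.Probability.RandomPlanarGeometry
open Literature.Probability.RandomPlanarGeometry.SAW

/-! ### Three facts about points of a segment of `ℂ` -/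

/-- Two points of a segment are no further apart than its endpoints:
`x, y ∈ [a, b] ⇒ dist x y ≤ dist a b` (sum of the two triangle inequalities through `a` and
through `b`, using `dist a x + dist x b = dist a b` and the same for `y`). -/
theorem dist_le_of_mem_segment {x y a b : ℂ} (hx : x ∈ segment ℝ a b)
    (hy : y ∈ segment ℝ a b) : dist x y ≤ dist a b := by
  have h1 := dist_add_dist_of_mem_segment hx
  have h2 := dist_add_dist_of_mem_segment hy
  have h3 := dist_triangle x a y
  have h4 := dist_triangle x b y
  rw [dist_comm x a] at h3
  rw [dist_comm b y] at h4
  linarith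

/-- A point of a segment is within the segment's length of the right endpoint:
`x ∈ [a, b] ⇒ dist x b ≤ dist a b`. -/
theorem dist_right_le_of_mem_segment {x a b : ℂ} (hx : x ∈ segment ℝ a b) :
    dist x b ≤ dist a b := by
  have h1 := dist_add_dist_of_mem_segment hx
  linarith [dist_nonneg (x := a) (y := x)]

/-- If a point of a segment is `ε`-far from `c`, so is one of the endpoints (the open ball
`B(c, ε)` is convex: if both endpoints were in it, the whole segment would be). -/
theorem far_endpoint_of_mem_segment {x a b c : ℂ} {ε : ℝ} (hx : x ∈ segment ℝ a b)
    (hε : ε ≤ dist x c) : ε ≤ dist a c ∨ ε ≤ dist b c := by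
  rcases le_or_gt ε (dist a c) with ha | ha
  · exact Or.inl ha
  rcases le_or_gt ε (dist b c) with hb | hb
  · exact Or.inr hb
  exfalso
  have hsub := (convex_ball c ε).segment_subset (Metric.mem_ball.2 ha) (Metric.mem_ball.2 hb) hx
  exact (not_lt.2 hε) (Metric.mem_ball.1 hsub)

/-! ### The stub -/

/-- **Stub 1 (polyline ⇒ vertex).** If the polyline of a SAW of `Ω_δ` is `ε`-far from `c` at a
time `s` and `r`-close to `c` at a later time `t`, and `r + δ < ε`, then some vertex `γ_i` is
`ε`-far from `c` and a LATER vertex `γ_j` (`i < j ≤ |γ|`) is `(r + δ)`-close to `c` (a polyline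
point lies on a lattice edge of length `δ`; balls are convex; edge indices are monotone in time). -/
theorem stub_polylineToVertex :
    ∀ (Ω : Set ℂ) (δ : ℝ) (u v : Site 2) (γ : DomainSAW Ω δ u v) (c : ℂ) (ε r : ℝ),
      0 < δ → r + δ < ε →
      (∃ s t : unitInterval, s < t ∧ ε ≤ dist (γ.walk.toCurve (meshPoint δ) s) c ∧
        dist (γ.walk.toCurve (meshPoint δ) t) c ≤ r) →
      ∃ i j : ℕ, i < j ∧ j ≤ γ.walk.length ∧ ε ≤ dist (meshPoint δ (γ.walk.getVert i)) c ∧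
        dist (meshPoint δ (γ.walk.getVert j)) c ≤ r + δ := by
  intro Ω δ u v γ c ε r hδ hrε ⟨s, t, hst, hs, ht⟩
  rw [AttachNoReturn.toCurve_apply_eq_uniform_clock] at hs ht
  -- the two clock values `σ ≤ τ` in `[0, |γ|]`
  have hσ := Polyline.clock_mem_Icc γ.walk.length ⟨s.2.1, s.2.2⟩
  have hτ := Polyline.clock_mem_Icc γ.walk.length ⟨t.2.1, t.2.2⟩
  have hστ : Polyline.clock γ.walk.length s ≤ Polyline.clock γ.walk.length t :=
    Polyline.monotone_clock _ (Subtype.coe_le_coe.2 hst.le)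
  generalize Polyline.clock γ.walk.length (s : ℝ) = σ at hs hσ hστ
  generalize Polyline.clock γ.walk.length (t : ℝ) = τ at ht hτ hστ
  -- the two polyline points are more than `δ` apart, hence `σ < τ` and `0 < |γ|`
  have hfar : δ < dist (Polyline.uniform (meshPoint δ u) (γ.walk.support.map (meshPoint δ)).tail σ)
      (Polyline.uniform (meshPoint δ u) (γ.walk.support.map (meshPoint δ)).tail τ) := by
    have := dist_triangle (Polyline.uniform (meshPoint δ u) (γ.walk.support.map (meshPoint δ)).tail σ)
      (Polyline.uniform (meshPoint δ u) (γ.walk.support.map (meshPoint δ)).tail τ) c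
    linarith
  have hστ' : σ < τ := by
    refine lt_of_le_of_ne hστ fun h => ?_
    rw [h, dist_self] at hfar
    linarith
  have hn0 : 0 < γ.walk.length := by
    have : (0 : ℝ) < γ.walk.length := by linarith [hσ.1, hτ.2]
    exact_mod_cast this
  -- both points lie on lattice edges `[δγ_k, δγ_{k+1}]`, `[δγ_m, δγ_{m+1}]` of length `δ`
  obtain ⟨k, hk, hkσ, -, hx⟩ :=
    AttachNoReturn.uniform_walk_mem_segment (meshPoint δ) γ.walk hn0 hσ.1 hσ.2
  obtain ⟨m, hm, -, hτm, hy⟩ :=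
    AttachNoReturn.uniform_walk_mem_segment (meshPoint δ) γ.walk hn0 hτ.1 hτ.2
  have hdk := AttachNoReturn.dist_meshPoint_getVert_succ hδ γ hk
  have hdm := AttachNoReturn.dist_meshPoint_getVert_succ hδ γ hm
  generalize Polyline.uniform (meshPoint δ u) (γ.walk.support.map (meshPoint δ)).tail σ = x
    at hs hx hfar
  generalize Polyline.uniform (meshPoint δ u) (γ.walk.support.map (meshPoint δ)).tail τ = y
    at ht hy hfar
  -- NEAR: `j := m + 1`
  have hnear : dist (meshPoint δ (γ.walk.getVert (m + 1))) c ≤ r + δ := by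
    have h1 := dist_right_le_of_mem_segment hy
    rw [hdm] at h1
    have h2 := dist_triangle_left (meshPoint δ (γ.walk.getVert (m + 1))) c y
    linarith
  -- ORDER: `k < m + 1`
  have hkm : k < m + 1 := by
    have : (k : ℝ) < m + 1 := by linarith
    exact_mod_cast this
  -- FAR: `i := k` or `i := k + 1`
  rcases far_endpoint_of_mem_segment hx hs with hfk | hfk
  · exact ⟨k, m + 1, hkm, hm, hfk, hnear⟩
  · refine ⟨k + 1, m + 1, ?_, hm, hfk, hnear⟩
    rcases Nat.lt_or_ge k m with hlt | hge
    · omega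
    · -- `k = m`: both points on one edge of length `δ`, contradicting `δ < dist x y`
      exfalso
      obtain rfl : k = m := by omega
      have := dist_le_of_mem_segment hx hy
      rw [hdk] at this
      linarith

end Summit.CriticalPhenomena.SAWScalingLimit.Theorems.NoDeepReturn.NakedRoot
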